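import Literature.MathematicalPhysics.QuantumFieldTheory.Balaban1983to89.T4HistoryLipschitzSegment

/-!
# NE9TwoPointKPOfPencil — the END's two-point binder `TwoPointKP` FROM THE PENCIL DATA: line-holomorphy of each activity in
the table on a ball, ONE table-free majorant there, occurring tables in a smaller ball

Cell `pub-balaban`, T4-DAG §2 node U3 / §5 row T4-U3.E / BINDER row NE9 (owner lineage `t4-ne9-p1`, gen 58; CRUX PROVER NE9 under
the coordinator ruling «YM REDIRECT» e34b3e0c — INTERFACE REQUEST NE9 in HOME/INBOX.md names the declarations below).
HONEST FRAMING (T4-DAG page 1): rung (B)+1 on a FIXED finite torus — NOT infinite volume, NOT a mass gap, NOT the Clay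
problem — and NOT a proof of NE9 for Bałaban's terms: the theorems below are one-variable complex analysis and bookkeeping
over ABSTRACT carriers; nothing about Bałaban's functionals is asserted, no named fact is introduced (D-0026), and the
conditionals BetaPertH, (B), (B^μ) do not occur.

WHY THIS LEAF.  The END of record of row NE9 (`Summits/…/T4Continuum/Support/NE9EndOfRecordPoints`) displays the binder
`TwoPointKP G W act 𝒜 n lip a d` of `T4HistoryLipschitzSegment` §3 (uniform clause, TABLE two-point clause with Lipschitz
scale `lip k`, `d`-weighted Kotecký–Preiss clause for `2n`).  The sibling leaf discharges it by the SEGMENT route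
(`twoPointKP_of_avgExpLinear`: the mean-value inequality inside the exponential), whose majorant `n` is then of the
(2.15)/(2.26) shape of [II] = [Balaban1988RG2Cluster] — an inequality proved INSIDE the proof of Lemma 3 and displayed for
print's own objects only (the row's class «(R-1) proof-interior», WALL-NE9-P1 §2 row A1).  The OLDER pencil route of
`T4HistoryLipschitzActivity` (`PotentialKPG`: activities line-holomorphic in the table on a ball `‖Q‖ < R₀`, a table-free
majorant `m` there, occurring tables of norm `≤ s₀ < R₀`) reaches `OutputLipschitz` directly, with its own END
(`ne9_and_fadingMemory_of_potentialKPG_perStep`), but not the END of record.  This leaf is the missing BRIDGE: pencil data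
⇒ `TwoPointKP` with `n := m` and the constant Lipschitz scale `lip k := 4/(R₀ − s₀)` (§2), through the one-activity Cauchy
estimate along the input pencil (§1).  With it the END of record is fed by EITHER route; which displayed inputs the pencil
route needs is a reading of print recorded in the cell (record `t4/T4-EST-NE9-P1.md` §65, GAPS G-ne9p1-58-1 re-opening
G-ne9p2-5 (i)), NOT asserted here: (T?) [II] Lemma 3 (2.38) p. 20 «|H(Z)| ≦ C₃ε₁exp(−(1 − 8δ)½Lκd_{k+1}(Z))» read over the
universe of discourse of [II] §2 — p. 11 last paragraph «We consider the integral in (I.2.13), with the fluctuation field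
action represented by (1.41)», (2.1) p. 12, p. 16 «The expression in the last exponential can be estimated using (1.42),
and the inequalities (1.43), (1.36)», radii (2.18) p. 16, ε₂ p. 19 l. 1, C₃ p. 20 — i.e. over the BOX of tables carrying
Lemma 2's listed properties (a ball for the weighted sup norm: `T4HistoryLipschitzSegment.closedBall_subset_boxSet`);
(K) line-holomorphy of exp-linear activities (`T4HistoryLipschitzActivity.potentialKPG_of_avgExpLinear`); (K) the KP clause
from decay of a deterministic majorant (`T4HistoryLipschitzEntropy.Supported.kpClause_of_decay`); (S) the room `s₀ < R₀`.

WHAT THIS LEAF PROVES (kernel; all [folklore]).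
(§1) `norm_sub_le_of_lineHolo_ball`: `w` line-holomorphic on the ball `‖·‖ < R₀` (`LineHolo`), `‖w‖ ≤ m` there, `‖Q‖, ‖Q′‖
≤ s₀ < R₀` ⇒ `‖w Q − w Q′‖ ≤ 4/(R₀ − s₀)·‖Q − Q′‖·m` — near pairs (`‖Q − Q′‖ ≤ (R₀ − s₀)/2`) by the tree's one-variable
Cauchy bound `T4ActivityLipschitz.norm_sub_le_div_of_ball` along `inputPencil Q Q′` (radius `(R₀ − s₀)/‖Q − Q′‖ ≥ 2`), far
pairs by the triangle inequality; the same split and constant as `T4HistoryLipschitzActivity.norm_clusterSum_sub_le_of_ballKPG`,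
one activity at a time.
(§2) `twoPointKP_of_lineHolo_ball`: `a, d ≥ 0`, `s₀ < R₀`, admissible sets `𝒜 k ⊆ closedBall 0 s₀`, and on the window at
every occurring coupling / background / scale-(k+1) domain: line-holomorphy of every activity of the step volume on the
ball, the bound `‖act Q γ‖ ≤ m γ` on the ball, and the `d`-weighted KP inequality for `2m` ⇒
`TwoPointKP G W act 𝒜 m (fun _ ↦ 4/(R₀ − s₀)) a d`.  `twoPointKP_of_potentialKPG`: the same from the sibling's binder
`PotentialKPG W act m a d R₀` plus the KP inequality for `2m` (the binder carries it for `m` only) and the occupation radius.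
(§3) `ne9_and_fadingMemory_of_lineHolo_ball_perStep`: the END-side corollary BY NAME — §2 ∘
`T4HistoryLipschitzSegment.ne9_and_fadingMemory_of_twoPointKP_perStep`: NE9 with the product moduli of rate
`ω + 4·(4/(R₀ − s₀))·B·τ̄` and `FadingMemory` of the same rate (fading iff `16Bτ̄ < (R₀ − s₀)(1 − ω)`, `fade_iff_room`).

References: [Balaban1988RG2Cluster] T. Bałaban, Renormalization group approach to lattice gauge field theories. II. Cluster
expansions, Comm. Math. Phys. 116 (1988) 1–22, Lemma 2 (1.41)–(1.43) p. 11, (2.1) p. 12, (2.14)–(2.15) p. 15, (2.18) p. 16,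
Lemma 3 (2.38) p. 20; [KoteckyPreiss1986] R. Kotecký, D. Preiss, Comm. Math. Phys. 103 (1986) 491–498, (1)–(3);
[Dimock2015] J. Dimock, The renormalization group according to Balaban III, difference formula (tree `Dimock2015.AnalyticLipschitz`).
-/

namespace Summit.QuantumFields.BalabanUV.T4Continuum.NE9TwoPointKPOfPencil

open scoped BigOperators
open Metric Set
open Literature.Probability.LatticeModels
open Literature.MathematicalPhysics.QuantumFieldTheory.Balaban1983to89
open Literature.MathematicalPhysics.QuantumFieldTheory.Balaban1983to89.T4OutputRate
open Literature.MathematicalPhysics.QuantumFieldTheory.Balaban1983to89.T4ActivityLipschitz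
open Literature.MathematicalPhysics.QuantumFieldTheory.Balaban1983to89.T4HistoryLipschitzRecursion
open Literature.MathematicalPhysics.QuantumFieldTheory.Balaban1983to89.T4HistoryLipschitzOuter
open Literature.MathematicalPhysics.QuantumFieldTheory.Balaban1983to89.T4HistoryLipschitzActivity
open Literature.MathematicalPhysics.QuantumFieldTheory.Balaban1983to89.T4HistoryLipschitzSegment
open Literature.MathematicalPhysics.QuantumFieldTheory.Balaban1983to89.T4HistoryLipschitzActivity (ClusterGeom)

/-! ## §1 One activity: Lipschitz in the table from line-holomorphy and a bound on a ball (kernel) -/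

section OneActivity

variable {Pot : Type*} [NormedAddCommGroup Pot] [NormedSpace ℂ Pot]

/-- **ONE-ACTIVITY PENCIL BOUND**: `w` line-holomorphic on the ball `‖·‖ < R₀` and bounded by `m` there, `‖Q‖, ‖Q′‖ ≤ s₀ <
R₀` ⇒ `‖w Q − w Q′‖ ≤ 4/(R₀ − s₀)·‖Q − Q′‖·m`.  Near pairs: Cauchy along the input pencil `z ↦ Q′ + z•(Q − Q′)` on the disc
of radius `(R₀ − s₀)/‖Q − Q′‖ ≥ 2` (`norm_sub_le_div_of_ball`, then `m/(R − 1) ≤ 2m/R`); far pairs: `2m ≤ 4m‖Q − Q′‖/(R₀ −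
s₀)`.  The TYPE of the bound on the ball is [II] Lemma 3 (2.38) p. 20 read over the tables of [II] §2 (module docstring;
displayed by whoever instantiates, asserted nowhere). [folklore] -/
theorem norm_sub_le_of_lineHolo_ball {w : Pot → ℂ} {m R₀ s₀ : ℝ} (hsR : s₀ < R₀) (hhol : LineHolo w R₀)
    (hm : ∀ Q ∈ ball (0 : Pot) R₀, ‖w Q‖ ≤ m) {Q Q' : Pot} (hQ : ‖Q‖ ≤ s₀) (hQ' : ‖Q'‖ ≤ s₀) :
    ‖w Q - w Q'‖ ≤ 4 / (R₀ - s₀) * ‖Q - Q'‖ * m := by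
  have hϱ : 0 < R₀ - s₀ := sub_pos.mpr hsR
  have hball : ball Q' (R₀ - s₀) ⊆ ball (0 : Pot) R₀ := ball_subset_ball_origin hQ'
  have hQb : Q ∈ ball (0 : Pot) R₀ := mem_ball_zero_iff.2 (lt_of_le_of_lt hQ hsR)
  have hQ'b : Q' ∈ ball (0 : Pot) R₀ := mem_ball_zero_iff.2 (lt_of_le_of_lt hQ' hsR)
  have hm0 : 0 ≤ m := (norm_nonneg _).trans (hm Q hQb)
  rcases le_or_gt ‖Q - Q'‖ ((R₀ - s₀) / 2) with hnear | hfar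
  · rcases (norm_nonneg (Q - Q')).eq_or_lt with h0 | hr
    · have hQQ : Q = Q' := sub_eq_zero.1 (norm_eq_zero.1 h0.symm)
      rw [hQQ, sub_self, norm_zero, sub_self, norm_zero, mul_zero, zero_mul]
    · have hR1 : 1 < (R₀ - s₀) / ‖Q - Q'‖ := by
        rw [one_lt_div hr]; linarith
      have hR2 : 2 ≤ (R₀ - s₀) / ‖Q - Q'‖ := by
        rw [le_div_iff₀ hr]; linarith
      have hfit : (R₀ - s₀) / ‖Q - Q'‖ * ‖Q - Q'‖ ≤ R₀ - s₀ := (div_mul_cancel₀ _ hr.ne').le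
      have hw : DifferentiableOn ℂ (fun z : ℂ => w (inputPencil Q Q' z)) (ball (0 : ℂ) ((R₀ - s₀) / ‖Q - Q'‖)) :=
        (hhol Q' (Q - Q')).mono fun z hz => hball (inputPencil_mem_ball hϱ hfit (mem_ball_zero_iff.1 hz))
      have hM : ∀ z : ℂ, ‖z‖ < (R₀ - s₀) / ‖Q - Q'‖ → ‖w (inputPencil Q Q' z)‖ ≤ m :=
        fun z hz => hm _ (hball (inputPencil_mem_ball hϱ hfit hz))
      have key := norm_sub_le_div_of_ball (f := fun z : ℂ => w (inputPencil Q Q' z)) hR1 hw hM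
      simp only [inputPencil_one, inputPencil_zero] at key
      have hden : 0 < (R₀ - s₀) / ‖Q - Q'‖ - 1 := by linarith
      calc ‖w Q - w Q'‖ ≤ m / ((R₀ - s₀) / ‖Q - Q'‖ - 1) := key
        _ ≤ m / ((R₀ - s₀) / ‖Q - Q'‖ / 2) :=
            div_le_div_of_nonneg_left hm0 (by positivity) (by linarith)
        _ = 2 / (R₀ - s₀) * ‖Q - Q'‖ * m := by
            field_simp
        _ ≤ 4 / (R₀ - s₀) * ‖Q - Q'‖ * m := by
            have h24 : 2 / (R₀ - s₀) ≤ 4 / (R₀ - s₀) := div_le_div_of_nonneg_right (by norm_num) hϱ.le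
            exact mul_le_mul_of_nonneg_right (mul_le_mul_of_nonneg_right h24 (norm_nonneg _)) hm0
  · calc ‖w Q - w Q'‖ ≤ ‖w Q‖ + ‖w Q'‖ := norm_sub_le _ _
      _ ≤ m + m := add_le_add (hm Q hQb) (hm Q' hQ'b)
      _ = 2 * m := by ring
      _ ≤ 4 / (R₀ - s₀) * ‖Q - Q'‖ * m := by
          have h1 : 2 ≤ 4 / (R₀ - s₀) * ‖Q - Q'‖ := by
            rw [div_mul_eq_mul_div, le_div_iff₀ hϱ]; linarith
          nlinarith

end OneActivity

/-! ## §2 The bridge: pencil data ⇒ `TwoPointKP` (kernel) -/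

section Bridge

variable {C : Carriers} (G : ClusterGeom C) {Bg : Type} {Pot : Type*} [NormedAddCommGroup Pot] [NormedSpace ℂ Pot]

/-- **`TwoPointKP` FROM PENCIL DATA.**  `a, d ≥ 0`; a room `s₀ < R₀`; admissible sets inside the closed ball of radius `s₀`;
and on the window, at every occurring last coupling `g k`, background `U` and scale-(k+1) domain `X`: every activity of the
step volume line-holomorphic in the table on the ball `‖Q‖ < R₀` (kernel for exp-linear activities), bounded there by the
table-free majorant `m k (g k) U γ` (TYPE: [II] Lemma 3 (2.38) p. 20 over the tables of §2 — module docstring), and the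
`d`-weighted KP inequality for `2m` (kernel from decay, sibling `Supported.kpClause_of_decay`).  Then the END's binder holds
with `n := m` and the constant Lipschitz scale `4/(R₀ − s₀)`: `TwoPointKP G W act 𝒜 m (fun _ ↦ 4/(R₀ − s₀)) a d`.
[cite: Balaban1988RG2Cluster, Lemma 3 (2.38) p.20 and (2.1) p.12; KoteckyPreiss1986, (1)-(3)] -/
theorem twoPointKP_of_lineHolo_ball {W : Set (ℕ → ℝ)} {act : ℕ → ℝ → Bg → Pot → G.P → ℂ} {𝒜 : ℕ → Set Pot}
    {m : ℕ → ℝ → Bg → G.P → ℝ} {a d : G.P → ℝ} {R₀ s₀ : ℝ} (ha : ∀ γ, 0 ≤ a γ) (hd : ∀ γ, 0 ≤ d γ)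
    (hsR : s₀ < R₀) (h𝒜 : ∀ k, 𝒜 k ⊆ closedBall (0 : Pot) s₀)
    (hhol : ∀ g ∈ W, ∀ (k : ℕ) (U : Bg) (X : C.Dom), C.scale X = k + 1 →
      ∀ γ ∈ G.vol X, LineHolo (fun Q => act k (g k) U Q γ) R₀)
    (hsup : ∀ g ∈ W, ∀ (k : ℕ) (U : Bg) (X : C.Dom), C.scale X = k + 1 →
      ∀ Q ∈ ball (0 : Pot) R₀, ∀ γ ∈ G.vol X, ‖act k (g k) U Q γ‖ ≤ m k (g k) U γ)
    (hkp2 : ∀ g ∈ W, ∀ (k : ℕ) (U : Bg) (X : C.Dom), C.scale X = k + 1 →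
      ∀ γ ∈ G.vol X, ∑ γ' ∈ G.vol X with G.inc γ' γ, 2 * m k (g k) U γ' * Real.exp (a γ' + d γ') ≤ a γ) :
    TwoPointKP G W act 𝒜 m (fun _ => 4 / (R₀ - s₀)) a d := by
  have hϱ : 0 < R₀ - s₀ := sub_pos.mpr hsR
  refine ⟨ha, hd, fun _ => (div_pos (by norm_num) hϱ).le, fun g hg k U X hX => ⟨?_, ?_, hkp2 g hg k U X hX⟩⟩
  · intro Q hQ γ hγ
    exact hsup g hg k U X hX Q
      (mem_ball_zero_iff.2 (lt_of_le_of_lt (mem_closedBall_zero_iff.1 (h𝒜 k hQ)) hsR)) γ hγ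
  · intro Q hQ Q' hQ' γ hγ
    exact norm_sub_le_of_lineHolo_ball hsR (hhol g hg k U X hX γ hγ) (fun p hp => hsup g hg k U X hX p hp γ hγ)
      (mem_closedBall_zero_iff.1 (h𝒜 k hQ)) (mem_closedBall_zero_iff.1 (h𝒜 k hQ'))

/-- **`TwoPointKP` FROM THE SIBLING'S PENCIL BINDER**: `PotentialKPG W act m a d R₀` (line-holomorphy, majorant on the
ball, KP for `m`) + the KP inequality for `2m` + admissible sets inside `closedBall 0 s₀`, `s₀ < R₀` ⇒
`TwoPointKP G W act 𝒜 m (fun _ ↦ 4/(R₀ − s₀)) a d`. [folklore] -/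
theorem twoPointKP_of_potentialKPG {W : Set (ℕ → ℝ)} {act : ℕ → ℝ → Bg → Pot → G.P → ℂ} {𝒜 : ℕ → Set Pot}
    {m : ℕ → ℝ → Bg → G.P → ℝ} {a d : G.P → ℝ} {R₀ s₀ : ℝ} (hK : G.PotentialKPG W act m a d R₀)
    (hsR : s₀ < R₀) (h𝒜 : ∀ k, 𝒜 k ⊆ closedBall (0 : Pot) s₀)
    (hkp2 : ∀ g ∈ W, ∀ (k : ℕ) (U : Bg) (X : C.Dom), C.scale X = k + 1 →
      ∀ γ ∈ G.vol X, ∑ γ' ∈ G.vol X with G.inc γ' γ, 2 * m k (g k) U γ' * Real.exp (a γ' + d γ') ≤ a γ) :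
    TwoPointKP G W act 𝒜 m (fun _ => 4 / (R₀ - s₀)) a d := by
  obtain ⟨ha, hd, hP⟩ := hK
  exact twoPointKP_of_lineHolo_ball G ha hd hsR h𝒜 (fun g hg k U X hX => (hP g hg k U X hX).1)
    (fun g hg k U X hX => (hP g hg k U X hX).2.1) hkp2

omit [NormedSpace ℂ Pot] in
/-- The occupation hypothesis of the pencil END (`‖ρ k (T k g′ (E g))‖ ≤ s₀`) is the occupation hypothesis of the END of
record (`ρ k (T k g′ (E g)) ∈ 𝒜 k`) for the admissible sets `𝒜 k := closedBall 0 s₀`. [folklore] -/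
theorem occ_closedBall_of_norm_le {ι : Type} {E : Functional C Bg} {W : Set (ℕ → ℝ)}
    {T : ℕ → (ℕ → ℝ) → (Bg → C.Dom → ℝ) → ι → ℝ} {ρ : ℕ → (ι → ℝ) → Pot} {s₀ : ℝ}
    (hocc : ∀ g ∈ W, ∀ g' ∈ W, ∀ k : ℕ, ‖ρ k (T k g' (E g))‖ ≤ s₀) :
    ∀ g ∈ W, ∀ g' ∈ W, ∀ k : ℕ, ρ k (T k g' (E g)) ∈ (fun _ : ℕ => closedBall (0 : Pot) s₀) k :=
  fun g hg g' hg' k => mem_closedBall_zero_iff.2 (hocc g hg g' hg' k)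

/-! ## §3 The END-side corollary by name -/

/-- **NE9 ∧ FADING MEMORY FROM PENCIL DATA THROUGH THE END OF RECORD'S ARCHITECTURE** — §2 ∘
`T4HistoryLipschitzSegment.ne9_and_fadingMemory_of_twoPointKP_perStep` with `𝒜 k := closedBall 0 s₀`, `lip k = lipbar :=
4/(R₀ − s₀)`: NE9 with the product moduli of rate `ω + 4·(4/(R₀ − s₀))·B·τ̄` and `FadingMemory` of the same rate.  Every
analytic input is a displayed binder (pencil data, channel data, decay extraction, pin budget, reading, occupation); nothing
printed is asserted. [folklore] -/
theorem ne9_and_fadingMemory_of_lineHolo_ball_perStep {ι : Type} {E : Functional C Bg} {W : Set (ℕ → ℝ)}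
    {Adm : Set (Bg → C.Dom → ℝ)} {T : ℕ → (ℕ → ℝ) → (Bg → C.Dom → ℝ) → ι → ℝ}
    {Ψ : ℕ → ℝ → (ι → ℝ) → Bg → C.Dom → ℝ} {act : ℕ → ℝ → Bg → Pot → G.P → ℂ}
    {m : ℕ → ℝ → Bg → G.P → ℝ} {a d : G.P → ℝ} {δ : C.Dom → ℝ} {κ B ℓ τbar ω R₀ s₀ : ℝ}
    {wt : ℕ → ι → ℝ} {τ : ℕ → ℕ → ℝ} {lam : ℕ → ℝ} (ρ : ℕ → (ι → ℝ) → Pot) (h0 : ScaleZeroFree E W)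
    (hAdm : AdmissibleTerms E W Adm) (hres : AdmRestrict Adm) (hadd : ChannelAdditive Adm T)
    (hsum : ChannelStepSum Adm T) (hstep : ChannelSizeAtStepNN Adm T κ wt τ) (hfac : Factorises E W T Ψ)
    (hlast : LastCouplingLipschitz E W T Ψ κ lam) (ha : ∀ γ, 0 ≤ a γ) (hd : ∀ γ, 0 ≤ d γ) (hsR : s₀ < R₀)
    (hhol : ∀ g ∈ W, ∀ (k : ℕ) (U : Bg) (X : C.Dom), C.scale X = k + 1 →
      ∀ γ ∈ G.vol X, LineHolo (fun Q => act k (g k) U Q γ) R₀)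
    (hsup : ∀ g ∈ W, ∀ (k : ℕ) (U : Bg) (X : C.Dom), C.scale X = k + 1 →
      ∀ Q ∈ ball (0 : Pot) R₀, ∀ γ ∈ G.vol X, ‖act k (g k) U Q γ‖ ≤ m k (g k) U γ)
    (hkp2 : ∀ g ∈ W, ∀ (k : ℕ) (U : Bg) (X : C.Dom), C.scale X = k + 1 →
      ∀ γ ∈ G.vol X, ∑ γ' ∈ G.vol X with G.inc γ' γ, 2 * m k (g k) U γ' * Real.exp (a γ' + d γ') ≤ a γ)
    (hdec : G.DecayExtract δ d) (hpin : G.PinBudget a δ (fun _ => B) κ)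
    (hρ : ∀ (k : ℕ) (P P' : ι → ℝ) (M : ℝ), (∀ y, |P y - P' y| ≤ wt k y * M) → ‖ρ k P - ρ k P'‖ ≤ M)
    (hΨ : ∀ (k : ℕ) (s : ℝ) (P P' : ι → ℝ) (U : Bg) (X : C.Dom),
      Ψ k s P U X - Ψ k s P' U X = (G.newTerm act k s U X (ρ k P) - G.newTerm act k s U X (ρ k P')).re)
    (hocc : ∀ g ∈ W, ∀ g' ∈ W, ∀ k : ℕ, ‖ρ k (T k g' (E g))‖ ≤ s₀) (hℓ : 0 ≤ ℓ) (hB : 0 ≤ B)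
    (hτbar : 0 ≤ τbar) (hω : 0 ≤ ω) (hpos : 0 < ω + 4 * (4 / (R₀ - s₀)) * B * τbar)
    (hlam : ∀ k, lam k ≤ ℓ) (hτ : ∀ k j, j ≤ k → 0 ≤ τ k j ∧ τ k j ≤ τbar * ω ^ (k - j)) :
    NE9 E W κ (prodModuli ℓ fun _ => ω + 4 * (4 / (R₀ - s₀)) * B * τbar) ∧
      FadingMemory (ℓ / (ω + 4 * (4 / (R₀ - s₀)) * B * τbar)) (ω + 4 * (4 / (R₀ - s₀)) * B * τbar)
        (prodModuli ℓ fun _ => ω + 4 * (4 / (R₀ - s₀)) * B * τbar) :=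
  ne9_and_fadingMemory_of_twoPointKP_perStep G ρ h0 hAdm hres hadd hsum hstep hfac hlast
    (twoPointKP_of_lineHolo_ball G (𝒜 := fun _ => closedBall (0 : Pot) s₀) ha hd hsR (fun _ => Subset.rfl) hhol hsup
      hkp2)
    hdec hpin hρ hΨ (occ_closedBall_of_norm_le (C := C) hocc) hℓ hB (fun _ => le_rfl) hτbar hω hpos hlam hτ

/-- The rate of §3 fades iff `16·B·τ̄ < (R₀ − s₀)(1 − ω)` — the pencil END's condition `4Bτ̄ < (R₀ − s₀)(1 − ω)`
(`T4HistoryLipschitzOuter.fade_of_radius`) with the factor 4 of the one-activity split of §1. [folklore] -/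
theorem fade_iff_room {ω B τbar R₀ s₀ : ℝ} (hsR : s₀ < R₀) :
    ω + 4 * (4 / (R₀ - s₀)) * B * τbar < 1 ↔ 16 * B * τbar < (R₀ - s₀) * (1 - ω) := by
  have hϱ : 0 < R₀ - s₀ := sub_pos.mpr hsR
  rw [show 4 * (4 / (R₀ - s₀)) * B * τbar = 16 * B * τbar / (R₀ - s₀) by ring]
  constructor
  · intro h
    have h' : 16 * B * τbar / (R₀ - s₀) < 1 - ω := by linarith
    rwa [div_lt_iff₀ hϱ, mul_comm (1 - ω)] at h'
  · intro h
    have h' : 16 * B * τbar / (R₀ - s₀) < 1 - ω := by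
      rw [div_lt_iff₀ hϱ, mul_comm (1 - ω)]; exact h
    linarith

end Bridge

end Summit.QuantumFields.BalabanUV.T4Continuum.NE9TwoPointKPOfPencil
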